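import Mathlib
import HarnessLib
import Summits.PneNP.Statement
import Literature.Computability.Complexity.ClayProblem
import Literature.Computability.Complexity.NPBridge
import Literature.Computability.Complexity.CircuitClassesUniformProofs

/-!
# PneNP / Circuit — the assembly `Assembly` (stmt-PneNP-10625), route-independent proof

Route `PneNP/Circuit`, assembly item stmt-PneNP-10625 (`Assembly`, rank 1, route rev 5):

  `CircuitThesis → PneNP`,  with  `CircuitThesis := ¬ (NP ⊆ P/poly)`.

If `¬ PneNP` then every language of Cook's `NP` over `{0,1}` (`PNPWave0.NP Bool`) lies in Cook's
`P` (`PNPWave0.P Bool`); transporting along the two PROVED model bridges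
`P_bool_eq_holds : PNPWave0.P Bool = Classes.P` (`ClayProblem.lean`) and
`np_bool_eq : PNPWave0.NP Bool = Nondeterministic.NP` (`NPBridge.lean`) and composing with the
proved inclusion `P_subset_PPoly_holds : Classes.P ⊆ PPoly` (`CircuitClassesUniformProofs.lean`,
Arora–Barak 2009 Thm. 6.6) gives `NP ⊆ P/poly`, contradicting the thesis.  This is, up to
unfolding the two route definitions `Assembly` and `CircuitThesis`, verbatim the type and the
proof of the route's kernel-checked deciding theorem `Summit.PneNP.PneNP.Theses.Circuit.closes`.

This module deliberately does NOT import the route file `Summits.PneNP.PneNP.Theses.Circuit`, so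
that the gate can import it INTO the route file for the `Assembly_holds` link without closing an
import cycle (the failure mode recorded for `Theorems/ConvexRankGatesAssembly.lean` and
`Theorems/SzkEntropyAssembly.lean`); against the route decl itself the statement closes by
`exact Summit.PneNP.PneNP.Theses.Circuit.closes` (or by this theorem, the two definitions unfolded).

References: S. Arora, B. Barak, *Computational Complexity: A Modern Approach* (2009), §6.4 and
Thm. 6.6 (`P ⊆ P/poly`); S. Cook, *The P versus NP problem*, Clay problem description (2000), §3.
-/

namespace Summit.PneNP.PneNP.Theorems

/-- **Assembly of route Circuit** (item stmt-PneNP-10625), stated over the tree's vocabulary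
without the route file: `¬ (NP ⊆ P/poly) → PneNP`.  Proof: if `¬ PneNP` then every
`L ∈ Nondeterministic.NP` is, through `np_bool_eq`, a Cook-`NP` language not outside Cook's `P`,
hence in `Classes.P` by `P_bool_eq_holds`, hence in `PPoly` by `P_subset_PPoly_holds`
(Arora–Barak 2009, Thm. 6.6) — so `NP ⊆ P/poly`, contradicting the hypothesis.
[AroraBarakCC2009, §6.4 and Thm. 6.6; CookClay2006, §3] -/
theorem circuit_assembly_standalone :
    ¬ (Literature.Computability.Complexity.Nondeterministic.NP ⊆
        Literature.Computability.Complexity.PPoly) → PneNP := by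
  intro hX
  by_contra h
  have hP : Literature.Computability.Complexity.PNPWave0.P Bool =
      Literature.Computability.Complexity.Classes.P :=
    Literature.Computability.Complexity.P_bool_eq_holds
  have hN : Literature.Computability.Complexity.PNPWave0.NP Bool =
      Literature.Computability.Complexity.Nondeterministic.NP :=
    Literature.Computability.Complexity.np_bool_eq
  apply hX
  intro L hL
  have hLP : L ∈ Literature.Computability.Complexity.PNPWave0.P Bool := by
    by_contra hL'
    exact h ⟨L, hN ▸ hL, hL'⟩
  exact Literature.Computability.Complexity.P_subset_PPoly_holds (hP ▸ hLP)

end Summit.PneNP.PneNP.Theorems
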